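import Summits.QuantumAdvantage.QuantumAdvantage.Theorems.AvgFaceBeyondPrior.Negative.AvgFaceBeyondPriorNecessary

/-!
# STRATEGY-CENSUS appendix — typed attempts that were REJECTED (crux stmt-QuantumAdvantage-2427)

Companion of `STRATEGY-CENSUS.md` (crux-strategist, 2026-08-17). Statements only where marked; the two
`theorem`s are kernel-checked. Nothing here is filed as an item.

* D1 / T4 (split through the binder = lattice-style worst-to-average transfer): `HeurToWorst` and the trivial
  glue `avgFace_of_binder_and_heurToWorst : IqThreeNotBPP → HeurToWorst → AvgFaceBeyondPrior`. Rejected: the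
  binder keeps ALL separation strength and `HeurToWorst` is a random self-reduction across discriminants that
  no class-number relation supports (BarrierNotes B4); circular at route level (the crux's only use is to give
  the binder).
* S⁺ (strengthen, δ-axis): `AvgFaceAtDelta δ` for `δ > 1/3` is STRONGER and refuted above `1/2` given
  Davenport–Heilbronn (`DeltaCeiling.not_strongFace_of_dh`); below, it is the same wall.
* The dichotomy reading of D1: `HeurToWorst ↔ (AvgFaceBeyondPrior ∨ iq3Lang ∈ BPP)` (`heurToWorst_iff`).
-/

set_option linter.dupNamespace false

namespace Summit.QuantumAdvantage.QuantumAdvantage.Cruxes.AvgFaceBeyondPrior.CensusSketch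

open _root_.Computability Literature.Computability.Complexity Literature.Computability.MetaComplexity
open Summit.QuantumAdvantage.QuantumAdvantage.Theorems.AvgFaceBeyondPrior
open Summit.QuantumAdvantage.QuantumAdvantage.Theses.ArithStatLadder

/-- D1/T4: heuristic-to-worst-case self-correction for `IQ3` at failure rate `1/3` (the only statement `P`
with `IqThreeNotBPP ∧ P ⇒ AvgFaceBeyondPrior` that is not itself `≥` the crux). [folklore] -/
def HeurToWorst : Prop :=
  Negative.Q ∈ HeurDeltaBPP (fun _ => (1:ℝ) / 3) → Negative.iq3Lang ∈ BPP

/-- The split through the binder is modus tollens. [folklore] -/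
theorem avgFace_of_binder_and_heurToWorst (h₁ : IqThreeNotBPP) (h₂ : HeurToWorst) : AvgFaceBeyondPrior :=
  fun hmem => h₁ (h₂ hmem)

/-- `HeurToWorst` is exactly "crux ∨ route-dead": it holds iff the crux holds or `IQ3 ∈ BPP`. [folklore] -/
theorem heurToWorst_iff : HeurToWorst ↔ (AvgFaceBeyondPrior ∨ Negative.iq3Lang ∈ BPP) := by
  constructor
  · intro h
    by_cases hc : AvgFaceBeyondPrior
    · exact Or.inl hc
    · right
      have hmem : Negative.Q ∈ HeurDeltaBPP (fun _ => (1:ℝ) / 3) := by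
        by_contra hn; exact hc hn
      exact h hmem
  · rintro (hc | hB) hmem
    · exact absurd hmem hc
    · exact hB

/-- S⁺ on the δ-axis (strengthening = larger allowed failure mass). [folklore] -/
def AvgFaceAtDelta (δ : ℝ) : Prop := Negative.Q ∉ HeurDeltaBPP (fun _ => δ)

/-- The crux is the `δ = 1/3` member. [folklore] -/
theorem avgFace_iff_atDelta : AvgFaceBeyondPrior ↔ AvgFaceAtDelta (1 / 3) := Iff.rfl

/-- Strengthening along δ is monotone the wrong way for provability: `δ ≤ δ'` and the `δ'`-face give the
`δ`-face (`Negative.not_mem_HeurDeltaBPP_anti`). [folklore] -/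
theorem atDelta_anti {δ δ' : ℝ} (h : δ ≤ δ') (h' : AvgFaceAtDelta δ') : AvgFaceAtDelta δ :=
  Negative.not_mem_HeurDeltaBPP_anti h h'

end Summit.QuantumAdvantage.QuantumAdvantage.Cruxes.AvgFaceBeyondPrior.CensusSketch
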